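import Summits.SmoothPoincare4.SmoothPoincare4.Theorems.EntropyRungConicalGapStubWeightedIdentity
import HarnessLib

/-!
# Stub `stub_weightedIntegrability` of line `Sketch` (crux `EntropyRung.ConicalGap`, stmt-SmoothPoincare4-16589)

Wang–Wang 2023 (arXiv:2308.06560, proof of Prop. 2.6: "the validity of `h(τ)` is ensured by the
quadratic growth of `f`"): on a complete connected normalised gradient shrinking Ricci soliton
`(Mⁿ, g, f)` (`Ric + Hess f = g/2`, `R + |∇f|² = f`, closed `g`-balls compact), for EVERY `τ > 0` the
three weights

  `e^{-f/τ}`, `f e^{-f/τ}`, `R e^{-f/τ}`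

are `dV`-integrable. The proof is the cut-off technique of Carrillo–Ni 2009, Cor. 2.1, already in the
tree for `τ = 1` (`CarrilloNi2009_shrinkerLSI.integral_cutoff_mul_sub_mul_exp_neg_nonpos`,
`CarrilloNi2009_shrinkerLSI.integrable_exp_neg_of_proper`), run with the weight `w = e^{-f/τ}`:

* Green's identity for the compactly supported cut-off `χ = φ(f/ρ)` against `w`
  (`integral_mul_dalembertian_eq_neg_integral_innerDual_of_hasCompactSupport`) and the pointwise
  formulas `τ² Δw = (f − τ n/2 + (τ − 1) R) w`, `g⁻¹(dχ, dw) = −τ⁻¹ w φ′(f/ρ) ρ⁻¹ |∇f|²`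
  (`weightedIdentity_dalembertian_expNegDiv`, `weightedIdentity_innerDual_mvfderiv_expNegDiv`) give
  `∫ φ(f/ρ) (f − τ n/2 + (τ − 1) R) e^{-f/τ} dV ≤ 0` (`weightedIntegrability_integral_cutoff_nonpos`);
* for `τ ≥ 1`, since `R ≥ 0` (a theorem of the tree, inside
  `NoncompactShrinkerGapCarrilloNiClauses.scalarCurvature_nonneg_and_isCompact_sublevel`, which also
  supplies the properness of `f`), this yields `∫ χ_k f e^{-f/τ} ≤ (τ n/2) ∫ χ_k e^{-f/τ}` along the
  exhaustion `χ_k = φ(f/(k+1)) → 1`, whence uniform bounds and Fatou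
  (`integrable_of_forall_integral_cutoff_mul_le`): `weightedIntegrability_of_one_le`;
* `0 < τ < 1` is dominated by `max τ 1` (`f ≥ 0`), and `R e^{-f/τ}` by `f e^{-f/τ}` (`0 ≤ R ≤ f`):
  `weightedIntegrability_riemVolume`.

Everything here is proved; no definition and no named fact is introduced.

## References

* Y. Wang, G. Wang (Wang–Wang 2023), arXiv:2308.06560, Prop. 2.6.
* [CarrilloNi2009] J. Carrillo, L. Ni, Comm. Anal. Geom. 17 (2009) 721–753, §2 (2.1)–(2.3), Cor. 2.1.
-/

noncomputable section

-- `Summit.SmoothPoincare4.SmoothPoincare4.…` (summit = problem) trips `dupNamespace` on every decl.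
set_option linter.dupNamespace false

open scoped Manifold ContDiff ENNReal NNReal Topology
open MeasureTheory Set Filter
open Literature.Geometry.Lorentzian Literature.Geometry.Riemannian

namespace Summit.SmoothPoincare4.SmoothPoincare4.Theorems.ConicalGapSketch

open CarrilloNi2009_shrinkerLSI

/-! ## The cut-off inequality and integrability over `g.riemVolume` (any dimension) -/

section ProperIntegrability

variable {n : ℕ} {M : Type*} [TopologicalSpace M] [ChartedSpace (EuclideanSpace ℝ (Fin n)) M]
  [IsManifold (𝓡 n) ∞ M] [T3Space M] [MeasurableSpace M] [BorelSpace M]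
  {g : PseudoRiemannianMetric (𝓡 n) ∞ (EuclideanSpace ℝ (Fin n)) (TangentSpace (𝓡 n) : M → Type _)}
  {f : M → ℝ} [g.HasLeviCivita]

/-- **The `τ`-weighted volume identity of a gradient shrinker, cut off** (Carrillo–Ni 2009, Cor. 2.1,
with the weight `e^{-f/τ}` of Wang–Wang 2023, Prop. 2.6): for `g` Riemannian, `f` smooth and proper
with `Ric + Hess f = g/2`, `R + |∇f|² = f`, a smooth non-increasing profile `φ` vanishing on `[2, ∞)`,
`ρ > 0` and `τ > 0`,
`∫ φ(f/ρ) (f − τ n/2 + (τ − 1) R) e^{-f/τ} dV ≤ 0`.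
Indeed `(f − τ n/2 + (τ − 1) R) e^{-f/τ} = τ² Δ(e^{-f/τ})` (`weightedIdentity_dalembertian_expNegDiv`),
and by Green's identity for the compactly supported `φ(f/ρ)`,
`∫ φ(f/ρ) Δ(e^{-f/τ}) = −∫ g⁻¹(dφ(f/ρ), d e^{-f/τ}) = (ρτ)⁻¹ ∫ φ′(f/ρ) |∇f|² e^{-f/τ} ≤ 0`. -/
theorem weightedIntegrability_integral_cutoff_nonpos (hg : g.IsRiemannian)
    (hf : ContMDiff (𝓡 n) 𝓘(ℝ, ℝ) ∞ f)
    (hsol : ∀ (x : M) (X Y : TangentSpace (𝓡 n) x),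
      g.ricci x X Y + g.hessian f x X Y = (1 / 2 : ℝ) * g.val x X Y)
    (hnorm : ∀ x : M, g.scalarCurvature x + g.gradSq f x = f x)
    (hprop : ∀ R : ℝ, IsCompact {x | f x ≤ R}) {φ : ℝ → ℝ} (hφs : ContDiff ℝ ∞ φ)
    (hφ0 : ∀ t, 2 ≤ t → φ t = 0) (hφa : Antitone φ) {ρ : ℝ} (hρ : 0 < ρ) {τ : ℝ} (hτ : 0 < τ) :
    ∫ x, φ (f x / ρ) * ((f x - τ * n / 2 + (τ - 1) * g.scalarCurvature x) *
      Real.exp (-f x / τ)) ∂g.riemVolume ≤ 0 := by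
  classical
  -- adapted from `CarrilloNi2009_shrinkerLSI.integral_cutoff_mul_sub_mul_exp_neg_nonpos` (τ = 1)
  -- topology supplied by the exhaustion
  haveI : SigmaCompactSpace M := ⟨⟨fun k : ℕ ↦ {x | f x ≤ k}, fun k ↦ hprop k,
    eq_univ_of_forall fun x ↦ mem_iUnion.2 (exists_nat_ge (f x))⟩⟩
  haveI : WeaklyLocallyCompactSpace M := ⟨fun x ↦ ⟨{y | f y ≤ f x + 1}, hprop _, by
    have hopen : IsOpen {y | f y < f x + 1} := isOpen_lt hf.continuous continuous_const
    exact mem_of_superset (hopen.mem_nhds (show x ∈ {y | f y < f x + 1} from lt_add_one (f x)))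
      fun y hy ↦ show f y ≤ f x + 1 from le_of_lt hy⟩⟩
  have hτ0 : τ ≠ 0 := hτ.ne'
  -- the cut-off `χ = φ (f / ρ)`
  set ζ : ℝ → ℝ := fun t ↦ φ (t / ρ) with hζ
  have hζs : ContDiff ℝ ∞ ζ := hφs.comp (contDiff_id.div_const _)
  have hζd : ∀ t, HasDerivAt ζ (deriv φ (t / ρ) / ρ) t := fun t ↦ by
    have h1 : HasDerivAt (fun s : ℝ ↦ s / ρ) (1 / ρ) t := (hasDerivAt_id t).div_const _
    have h2 : HasDerivAt φ (deriv φ (t / ρ)) (t / ρ) :=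
      (hφs.differentiable (by norm_num) _).hasDerivAt
    simpa [hζ, div_eq_mul_inv, Function.comp_def] using h2.comp t h1
  set χ : M → ℝ := fun x ↦ ζ (f x) with hχ
  have hχs : ContMDiff (𝓡 n) 𝓘(ℝ, ℝ) 1 χ := (hζs.comp_contMDiff hf).of_le ENat.LEInfty.out
  have hχc : HasCompactSupport χ := by
    refine HasCompactSupport.intro (hprop (2 * ρ)) fun x hx ↦ ?_
    have hx' : 2 * ρ < f x := lt_of_not_ge hx
    exact hφ0 _ (by rw [le_div_iff₀ hρ]; linarith)
  -- Green's identity for `χ` against `w = e^{-f/τ}`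
  have hw : ContMDiff (𝓡 n) 𝓘(ℝ, ℝ) 2 (fun y ↦ Real.exp (-f y / τ)) :=
    ((Real.contDiff_exp.comp (contDiff_neg.div_const τ)).comp_contMDiff hf).of_le ENat.LEInfty.out
  have hGreen : ∫ x, χ x * g.dalembertian (fun y ↦ Real.exp (-f y / τ)) x ∂g.riemVolume =
      -∫ x, g.innerDual x (mvfderiv (𝓡 n) χ x).toLinearMap
        (mvfderiv (𝓡 n) (fun y ↦ Real.exp (-f y / τ)) x).toLinearMap ∂g.riemVolume := by
    haveI := (PseudoRiemannianMetric.ofRiemannian (g.toContMDiffRiemannianMetric hg)).hasLeviCivita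
    have h1 := integral_mul_dalembertian_eq_neg_integral_innerDual_of_hasCompactSupport
      (g.toContMDiffRiemannianMetric hg) hχs hχc hw
    rw [PseudoRiemannianMetric.riemVolume_eq hg]
    exact h1
  -- identify both integrands
  have hL : ∀ x, φ (f x / ρ) * ((f x - τ * n / 2 + (τ - 1) * g.scalarCurvature x) *
      Real.exp (-f x / τ)) = τ ^ 2 * (χ x * g.dalembertian (fun y ↦ Real.exp (-f y / τ)) x) :=
    fun x ↦ by
    rw [weightedIdentity_dalembertian_expNegDiv hsol hnorm hf τ x]
    simp only [hχ, hζ]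
    field_simp
    ring
  have hRt : ∀ x, g.innerDual x (mvfderiv (𝓡 n) χ x).toLinearMap
      (mvfderiv (𝓡 n) (fun y ↦ Real.exp (-f y / τ)) x).toLinearMap =
      τ⁻¹ * (-deriv φ (f x / ρ) / ρ) * (Real.exp (-f x / τ) * g.gradSq f x) := fun x ↦ by
    have hfx : MDifferentiableAt (𝓡 n) 𝓘(ℝ, ℝ) f x := hf.mdifferentiableAt (by norm_num)
    have hdχ : (mvfderiv (𝓡 n) χ x).toLinearMap =
        (deriv φ (f x / ρ) / ρ) • (mvfderiv (𝓡 n) f x).toLinearMap := by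
      ext v
      have := mvfderiv_real_comp_apply (I := 𝓡 n) (hζd (f x)) hfx v
      simpa [hχ, Function.comp_def] using this
    rw [weightedIdentity_innerDual_mvfderiv_expNegDiv τ hfx, hdχ]
    have h1 : g.innerDual x ((deriv φ (f x / ρ) / ρ) • (mvfderiv (𝓡 n) f x).toLinearMap)
        (mvfderiv (𝓡 n) f x).toLinearMap =
        deriv φ (f x / ρ) / ρ * g.innerDual x (mvfderiv (𝓡 n) f x).toLinearMap
          (mvfderiv (𝓡 n) f x).toLinearMap := by
      simp only [PseudoRiemannianMetric.innerDual, LinearMap.smul_apply, smul_eq_mul]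
    rw [h1, PseudoRiemannianMetric.gradSq]
    ring
  have hRt0 : ∀ x, 0 ≤ g.innerDual x (mvfderiv (𝓡 n) χ x).toLinearMap
      (mvfderiv (𝓡 n) (fun y ↦ Real.exp (-f y / τ)) x).toLinearMap := fun x ↦ by
    rw [hRt x]
    have hd : deriv φ (f x / ρ) ≤ 0 := hφa.deriv_nonpos
    exact mul_nonneg (mul_nonneg (inv_nonneg.2 hτ.le) (div_nonneg (neg_nonneg.2 hd) hρ.le))
      (mul_nonneg (Real.exp_pos _).le (g.gradSq_nonneg hg f x))
  calc ∫ x, φ (f x / ρ) * ((f x - τ * n / 2 + (τ - 1) * g.scalarCurvature x) *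
        Real.exp (-f x / τ)) ∂g.riemVolume
      = ∫ x, τ ^ 2 * (χ x * g.dalembertian (fun y ↦ Real.exp (-f y / τ)) x) ∂g.riemVolume :=
        integral_congr_ae (Eventually.of_forall hL)
    _ = τ ^ 2 * -∫ x, g.innerDual x (mvfderiv (𝓡 n) χ x).toLinearMap
          (mvfderiv (𝓡 n) (fun y ↦ Real.exp (-f y / τ)) x).toLinearMap ∂g.riemVolume := by
        rw [integral_const_mul, hGreen]
    _ ≤ 0 := mul_nonpos_of_nonneg_of_nonpos (sq_nonneg τ) (neg_nonpos.2 (integral_nonneg hRt0))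

/-- **`e^{-f/τ}` and `f e^{-f/τ}` are integrable for `τ ≥ 1`** on a gradient shrinker with proper
potential and `R ≥ 0` (Wang–Wang 2023, Prop. 2.6; the Fatou argument of Carrillo–Ni 2009, Cor. 2.1 =
`CarrilloNi2009_shrinkerLSI.integrable_exp_neg_of_proper`): from
`weightedIntegrability_integral_cutoff_nonpos` and `R ≥ 0`, `∫ χ_k f e^{-f/τ} ≤ (τ n/2) ∫ χ_k e^{-f/τ}`
for the cut-offs `χ_k = φ(f/(k+1))`, whence (`f ≥ 0`, `m = τ n + 1`)
`∫ χ_k e^{-f/τ} ≤ ∫_{f ≤ m} e^{-f/τ} + m⁻¹ ∫ χ_k f e^{-f/τ} ≤ ∫_{f ≤ m} e^{-f/τ} + ½ ∫ χ_k e^{-f/τ}`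
uniformly in `k`, and Fatou (`integrable_of_forall_integral_cutoff_mul_le`). -/
theorem weightedIntegrability_of_one_le (hg : g.IsRiemannian) (hf : ContMDiff (𝓡 n) 𝓘(ℝ, ℝ) ∞ f)
    (hsol : ∀ (x : M) (X Y : TangentSpace (𝓡 n) x),
      g.ricci x X Y + g.hessian f x X Y = (1 / 2 : ℝ) * g.val x X Y)
    (hnorm : ∀ x : M, g.scalarCurvature x + g.gradSq f x = f x)
    (hprop : ∀ R : ℝ, IsCompact {x | f x ≤ R}) (hR0 : ∀ x, 0 ≤ g.scalarCurvature x) {τ : ℝ}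
    (hτ : 1 ≤ τ) :
    Integrable (fun x ↦ Real.exp (-f x / τ)) g.riemVolume ∧
      Integrable (fun x ↦ f x * Real.exp (-f x / τ)) g.riemVolume := by
  classical
  -- adapted from `CarrilloNi2009_shrinkerLSI.integrable_exp_neg_of_proper` (τ = 1), with `f ≥ 0`
  haveI := isFiniteMeasureOnCompacts_riemVolume hg
  obtain ⟨φ, hφs, hφ1, hφ0, hφ01, hφa⟩ := exists_antitone_cutoffProfile
  have hτ0 : 0 < τ := one_pos.trans_le hτ
  have hf0 : ∀ x, 0 ≤ f x := fun x ↦ by linarith [hnorm x, hR0 x, g.gradSq_nonneg hg f x]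
  -- notation
  set E : M → ℝ := fun x ↦ Real.exp (-f x / τ) with hEdef
  have hE : Continuous E := Real.continuous_exp.comp (hf.continuous.neg.div_const _)
  have hE0 : ∀ x, 0 < E x := fun x ↦ Real.exp_pos _
  have hSc : Continuous fun x ↦ g.scalarCurvature x :=
    (PseudoRiemannianMetric.contMDiff_scalarCurvature g).continuous
  set m : ℝ := τ * n + 1 with hm
  have hm0 : 0 < m := by positivity
  set A : Set M := {x | f x ≤ m} with hA
  have hAc : IsCompact A := hprop m
  have hAm : MeasurableSet A := (isClosed_le hf.continuous continuous_const).measurableSet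
  -- the constant `C₀ = ∫_A e^{-f/τ}`
  have hC₀i : Integrable (A.indicator E) g.riemVolume :=
    (hE.continuousOn.integrableOn_compact hAc).integrable_indicator hAm
  set C₀ : ℝ := ∫ x, A.indicator E x ∂g.riemVolume with hC₀
  -- the cut-offs
  set χ : ℕ → M → ℝ := fun k x ↦ φ (f x / (k + 1)) with hχ
  have hχcont : ∀ k, Continuous (χ k) := fun k ↦
    hφs.continuous.comp (hf.continuous.div_const _)
  have hχc : ∀ k : ℕ, HasCompactSupport (χ k) := fun k ↦ by
    refine HasCompactSupport.intro (hprop (2 * (k + 1))) fun x hx ↦ ?_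
    have hx' : 2 * ((k : ℝ) + 1) < f x := lt_of_not_ge hx
    have hk : (0 : ℝ) < k + 1 := by positivity
    exact hφ0 _ (by rw [le_div_iff₀ hk]; linarith)
  have hχ0 : ∀ k x, 0 ≤ χ k x := fun k x ↦ (hφ01 _).1
  have hχ1 : ∀ k x, χ k x ≤ 1 := fun k x ↦ (hφ01 _).2
  have hχlim : ∀ x, Tendsto (fun k ↦ χ k x) atTop (𝓝 1) := fun x ↦ by
    refine tendsto_const_nhds.congr' ?_
    obtain ⟨N, hN⟩ := exists_nat_ge (f x)
    filter_upwards [eventually_ge_atTop N] with k hk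
    refine (hφ1 _ ?_).symm
    rw [div_le_one (by positivity)]
    calc f x ≤ N := hN
      _ ≤ k := by exact_mod_cast hk
      _ ≤ k + 1 := by linarith
  have iE : ∀ k, Integrable (fun x ↦ χ k x * E x) g.riemVolume := fun k ↦
    ((hχcont k).mul hE).integrable_of_hasCompactSupport (hχc k).mul_right
  have ifE : ∀ k, Integrable (fun x ↦ χ k x * (f x * E x)) g.riemVolume := fun k ↦
    ((hχcont k).mul (hf.continuous.mul hE)).integrable_of_hasCompactSupport (hχc k).mul_right
  have iSE : ∀ k, Integrable (fun x ↦ χ k x * (g.scalarCurvature x * E x)) g.riemVolume := fun k ↦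
    ((hχcont k).mul (hSc.mul hE)).integrable_of_hasCompactSupport (hχc k).mul_right
  -- the key inequality `∫ χ_k f e^{-f/τ} ≤ (τ n/2) ∫ χ_k e^{-f/τ}` (here `R ≥ 0`, `τ ≥ 1` enter)
  have hkey : ∀ k, ∫ x, χ k x * (f x * E x) ∂g.riemVolume ≤
      τ * n / 2 * ∫ x, χ k x * E x ∂g.riemVolume := fun k ↦ by
    have h := weightedIntegrability_integral_cutoff_nonpos hg hf hsol hnorm hprop hφs hφ0 hφa
      (ρ := (k : ℝ) + 1) (by positivity) hτ0
    have hsplit : ∀ x, φ (f x / ((k : ℝ) + 1)) *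
        ((f x - τ * n / 2 + (τ - 1) * g.scalarCurvature x) * Real.exp (-f x / τ)) =
        χ k x * (f x * E x) - τ * n / 2 * (χ k x * E x) +
          (τ - 1) * (χ k x * (g.scalarCurvature x * E x)) := fun x ↦ by
      simp only [hχ, hEdef]
      ring
    simp_rw [hsplit] at h
    have i3 : Integrable (fun x ↦ τ * n / 2 * (χ k x * E x)) g.riemVolume := (iE k).const_mul _
    have i1 : Integrable (fun x ↦ χ k x * (f x * E x) - τ * n / 2 * (χ k x * E x)) g.riemVolume :=
      (ifE k).sub i3
    have i2 : Integrable (fun x ↦ (τ - 1) * (χ k x * (g.scalarCurvature x * E x))) g.riemVolume :=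
      (iSE k).const_mul _
    rw [integral_add i1 i2, integral_sub (ifE k) i3, integral_const_mul, integral_const_mul] at h
    have hS : 0 ≤ ∫ x, χ k x * (g.scalarCurvature x * E x) ∂g.riemVolume :=
      integral_nonneg fun x ↦ mul_nonneg (hχ0 k x) (mul_nonneg (hR0 x) (hE0 x).le)
    nlinarith [mul_nonneg (sub_nonneg.2 hτ) hS]
  -- `I_k ≤ 2 C₀`
  have hI : ∀ k, ∫ x, χ k x * E x ∂g.riemVolume ≤ 2 * C₀ := fun k ↦ by
    have hpt : ∀ x, χ k x * E x ≤ A.indicator E x + m⁻¹ * (χ k x * (f x * E x)) := fun x ↦ by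
      by_cases hx : x ∈ A
      · rw [indicator_of_mem hx]
        have h1 : χ k x * E x ≤ E x := mul_le_of_le_one_left (hE0 x).le (hχ1 k x)
        have h2 : 0 ≤ m⁻¹ * (χ k x * (f x * E x)) :=
          mul_nonneg (inv_nonneg.2 hm0.le) (mul_nonneg (hχ0 k x) (mul_nonneg (hf0 x) (hE0 x).le))
        linarith
      · rw [indicator_of_notMem hx]
        have hfx : m < f x := lt_of_not_ge hx
        have h1 : 1 ≤ m⁻¹ * f x := by
          rw [inv_mul_eq_div, le_div_iff₀ hm0]; linarith
        have h2 : 0 ≤ χ k x * E x := mul_nonneg (hχ0 k x) (hE0 x).le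
        nlinarith
    have i2 : Integrable (fun x ↦ m⁻¹ * (χ k x * (f x * E x))) g.riemVolume := (ifE k).const_mul _
    have h1 : ∫ x, χ k x * E x ∂g.riemVolume ≤
        C₀ + m⁻¹ * ∫ x, χ k x * (f x * E x) ∂g.riemVolume :=
      calc ∫ x, χ k x * E x ∂g.riemVolume
          ≤ ∫ x, (A.indicator E x + m⁻¹ * (χ k x * (f x * E x))) ∂g.riemVolume :=
            integral_mono (iE k) (hC₀i.add i2) hpt
        _ = C₀ + m⁻¹ * ∫ x, χ k x * (f x * E x) ∂g.riemVolume := by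
            rw [integral_add hC₀i i2, integral_const_mul]
    have h2 := hkey k
    have hIpos : 0 ≤ ∫ x, χ k x * E x ∂g.riemVolume :=
      integral_nonneg fun x ↦ mul_nonneg (hχ0 k x) (hE0 x).le
    have h3 : m⁻¹ * (τ * n / 2 * ∫ x, χ k x * E x ∂g.riemVolume) ≤
        1 / 2 * ∫ x, χ k x * E x ∂g.riemVolume := by
      rw [← mul_assoc]
      refine mul_le_mul_of_nonneg_right ?_ hIpos
      rw [inv_mul_le_iff₀ hm0]
      simp only [hm]
      linarith
    have h4 : m⁻¹ * ∫ x, χ k x * (f x * E x) ∂g.riemVolume ≤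
        m⁻¹ * (τ * n / 2 * ∫ x, χ k x * E x ∂g.riemVolume) :=
      mul_le_mul_of_nonneg_left h2 (inv_nonneg.2 hm0.le)
    have hC₀0 : 0 ≤ C₀ := integral_nonneg fun x ↦ indicator_nonneg (fun y _ ↦ (hE0 y).le) x
    linarith
  -- `∫ χ_k f e^{-f/τ} ≤ τ n C₀`
  have hJ : ∀ k, ∫ x, χ k x * (f x * E x) ∂g.riemVolume ≤ τ * n * C₀ := fun k ↦ by
    have h0 : 0 ≤ τ * n / 2 := by positivity
    calc ∫ x, χ k x * (f x * E x) ∂g.riemVolume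
        ≤ τ * n / 2 * ∫ x, χ k x * E x ∂g.riemVolume := hkey k
      _ ≤ τ * n / 2 * (2 * C₀) := mul_le_mul_of_nonneg_left (hI k) h0
      _ = τ * n * C₀ := by ring
  -- Fatou
  exact ⟨integrable_of_forall_integral_cutoff_mul_le hE.aestronglyMeasurable (fun x ↦ (hE0 x).le)
      hχ0 iE hχlim hI,
    integrable_of_forall_integral_cutoff_mul_le (hf.continuous.mul hE).aestronglyMeasurable
      (fun x ↦ mul_nonneg (hf0 x) (hE0 x).le) hχ0 ifE hχlim hJ⟩

/-- **The three weights `e^{-f/τ}`, `f e^{-f/τ}`, `R e^{-f/τ}` are integrable for every `τ > 0`** on a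
gradient shrinker with proper potential and `R ≥ 0` (Wang–Wang 2023, Prop. 2.6), over `g.riemVolume`:
`weightedIntegrability_of_one_le` at `max τ 1`, then domination — `e^{-f/τ} ≤ e^{-f/max τ 1}` as `f ≥ 0`,
and `0 ≤ R ≤ f` (`R + |∇f|² = f`, `|∇f|² ≥ 0`). -/
theorem weightedIntegrability_riemVolume (hg : g.IsRiemannian) (hf : ContMDiff (𝓡 n) 𝓘(ℝ, ℝ) ∞ f)
    (hsol : ∀ (x : M) (X Y : TangentSpace (𝓡 n) x),
      g.ricci x X Y + g.hessian f x X Y = (1 / 2 : ℝ) * g.val x X Y)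
    (hnorm : ∀ x : M, g.scalarCurvature x + g.gradSq f x = f x)
    (hprop : ∀ R : ℝ, IsCompact {x | f x ≤ R}) (hR0 : ∀ x, 0 ≤ g.scalarCurvature x) {τ : ℝ}
    (hτ : 0 < τ) :
    Integrable (fun x ↦ Real.exp (-f x / τ)) g.riemVolume ∧
      Integrable (fun x ↦ f x * Real.exp (-f x / τ)) g.riemVolume ∧
      Integrable (fun x ↦ g.scalarCurvature x * Real.exp (-f x / τ)) g.riemVolume := by
  have hf0 : ∀ x, 0 ≤ f x := fun x ↦ by linarith [hnorm x, hR0 x, g.gradSq_nonneg hg f x]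
  have hRle : ∀ x, g.scalarCurvature x ≤ f x := fun x ↦ by
    linarith [hnorm x, g.gradSq_nonneg hg f x]
  obtain ⟨iE', iF'⟩ :=
    weightedIntegrability_of_one_le hg hf hsol hnorm hprop hR0 (le_max_right τ 1)
  have hE : Continuous fun x ↦ Real.exp (-f x / τ) :=
    Real.continuous_exp.comp (hf.continuous.neg.div_const _)
  have hSc : Continuous fun x ↦ g.scalarCurvature x :=
    (PseudoRiemannianMetric.contMDiff_scalarCurvature g).continuous
  -- pointwise domination `e^{-f/τ} ≤ e^{-f / max τ 1}`
  have hdom : ∀ x, Real.exp (-f x / τ) ≤ Real.exp (-f x / max τ 1) := fun x ↦ by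
    refine Real.exp_le_exp.2 ?_
    rw [neg_div, neg_div, neg_le_neg_iff]
    exact div_le_div_of_nonneg_left (hf0 x) hτ (le_max_left τ 1)
  have iE : Integrable (fun x ↦ Real.exp (-f x / τ)) g.riemVolume := by
    refine iE'.mono hE.aestronglyMeasurable (Eventually.of_forall fun x ↦ ?_)
    rw [Real.norm_eq_abs, Real.norm_eq_abs, abs_of_pos (Real.exp_pos _),
      abs_of_pos (Real.exp_pos _)]
    exact hdom x
  have iF : Integrable (fun x ↦ f x * Real.exp (-f x / τ)) g.riemVolume := by
    refine iF'.mono (hf.continuous.mul hE).aestronglyMeasurable (Eventually.of_forall fun x ↦ ?_)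
    rw [Real.norm_eq_abs, Real.norm_eq_abs, abs_of_nonneg (mul_nonneg (hf0 x) (Real.exp_pos _).le),
      abs_of_nonneg (mul_nonneg (hf0 x) (Real.exp_pos _).le)]
    exact mul_le_mul_of_nonneg_left (hdom x) (hf0 x)
  refine ⟨iE, iF, iF.mono (hSc.mul hE).aestronglyMeasurable (Eventually.of_forall fun x ↦ ?_)⟩
  rw [Real.norm_eq_abs, Real.norm_eq_abs, abs_of_nonneg (mul_nonneg (hR0 x) (Real.exp_pos _).le),
    abs_of_nonneg (mul_nonneg (hf0 x) (Real.exp_pos _).le)]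
  exact mul_le_mul_of_nonneg_right (hRle x) (Real.exp_pos _).le

end ProperIntegrability

/-! ## The registered stub -/

/-- **Stub `stub_weightedIntegrability` of line `Sketch`** (Wang–Wang 2023, arXiv:2308.06560, proof of
Prop. 2.6, `n = 4`; Carrillo–Ni 2009, Cor. 2.1 technique): on every complete connected normalised 4-d
gradient shrinking Ricci soliton the weights `e^{-f/τ}`, `f e^{-f/τ}`, `R e^{-f/τ}` are integrable for
EVERY `τ > 0` (`dV` the Riemannian measure of `g.toContMDiffRiemannianMetric hg`, to which
`g.riemVolume` unfolds by `riemVolume_eq`): `R ≥ 0` and properness of `f`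
(`NoncompactShrinkerGapCarrilloNiClauses.scalarCurvature_nonneg_and_isCompact_sublevel`), then
`weightedIntegrability_riemVolume`. -/
theorem stub_weightedIntegrability : ∀ (M : Type) [TopologicalSpace M] [T2Space M] [SecondCountableTopology M] [ChartedSpace (EuclideanSpace ℝ (Fin 4)) M] [IsManifold (𝓡 4) ∞ M] [ConnectedSpace M] [T3Space M] [MeasurableSpace M] [BorelSpace M] (g : Literature.Geometry.Lorentzian.PseudoRiemannianMetric (𝓡 4) ∞ (EuclideanSpace ℝ (Fin 4)) (TangentSpace (𝓡 4) : M → Type _)) [g.HasLeviCivita] (f : M → ℝ) (hg : g.IsRiemannian), (∀ (x : M) (r : NNReal), IsCompact {y : M | g.edist hg x y ≤ r}) → ContMDiff (𝓡 4) 𝓘(ℝ, ℝ) ∞ f → (∀ (x : M) (X Y : TangentSpace (𝓡 4) x), g.ricci x X Y + g.hessian f x X Y = (1 / 2 : ℝ) * g.val x X Y) → (∀ x : M, g.scalarCurvature x + g.gradSq f x = f x) → ∀ τ : ℝ, 0 < τ → MeasureTheory.Integrable (fun x ↦ Real.exp (-f x / τ)) (Literature.Geometry.Lorentzian.riemannianMeasure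 (g.toContMDiffRiemannianMetric hg)) ∧ MeasureTheory.Integrable (fun x ↦ f x * Real.exp (-f x / τ)) (Literature.Geometry.Lorentzian.riemannianMeasure (g.toContMDiffRiemannianMetric hg)) ∧ MeasureTheory.Integrable (fun x ↦ g.scalarCurvature x * Real.exp (-f x / τ)) (Literature.Geometry.Lorentzian.riemannianMeasure (g.toContMDiffRiemannianMetric hg)) := by
  intro M _ _ _ _ _ _ _ _ _ g _ f hg hc hf hsol hnorm τ hτ
  obtain ⟨hR0, -, hprop⟩ :=
    NoncompactShrinkerGapCarrilloNiClauses.scalarCurvature_nonneg_and_isCompact_sublevel g f hg hc hf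
      hsol hnorm
  rw [← PseudoRiemannianMetric.riemVolume_eq hg]
  exact weightedIntegrability_riemVolume hg hf hsol hnorm hprop hR0 hτ

end Summit.SmoothPoincare4.SmoothPoincare4.Theorems.ConicalGapSketch

end
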